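import Summits.NavierStokesRegularity.FunctionalMining.NonlinearPoincareHolderMap
import Summits.NavierStokesRegularity.FunctionalMining.CodomainNPRegularisation
import Summits.NavierStokesRegularity.FunctionalMining.CodomainSobolev
import HarnessLib

/-!
# FunctionalMining — the nonlinear Poincaré inequality at a real parameter, codomain-generic:
# `∫‖u‖^{2a+2} ≤ C(a,d) ∫‖u‖^{2a}∑ₖ‖∂ₖu‖²` for zero-mean smooth `u : T^d → F`

Search for candidate a priori estimates; no regularity claim. Cell `pub-nsfunc`, prove seat
(gen 9). The codomain-generic twin of `NonlinearPoincareRpow` (typed there for fields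
`T^d → EuclideanSpace ℝ d`): the same constructive argument for smooth zero-mean maps into a
finite-dimensional real inner-product space `F` — mean control `‖∫‖u‖^a u‖ ≤ 3^{1+a}‖W − ∫W‖₂`
from the `β`-Hölder map bound of `NonlinearPoincareHolderMap` (already codomain-generic), the
regularisation `W_ε = (‖u‖²+ε)^{a/2}u` of `CodomainNPRegularisation`, the coordinate-form
Poincaré–Wirtinger inequality of `CodomainSobolev`, and `ε → 0⁺` by continuity of parametric
integrals. Needed for tensor-valued test maps (`|S|^{a} S`: strain moments, rows `ES.absS.q` of the
𝒦₀ matrix).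

## Main statements

* `norm_integral_rpow_smul_le` — mean control.
* `integral_norm_rpow_le_weighted` — **NP(a)**, `0 < a ≤ 2`:
  `∫‖u‖^{2a+2} ≤ 6 (1 + (3^{1+a})²) (1+a)² d³ ∫‖u‖^{2a}∑ₖ‖∂ₖu‖²`.
-/

noncomputable section

open MeasureTheory Finset Set Filter
open scoped InnerProductSpace RealInnerProductSpace ContDiff Topology

namespace Summit.NavierStokesRegularity.FunctionalMining

open Literature.Analysis.FunctionSpaces Literature.Analysis.FunctionSpaces.Torus

namespace CodomainNP

variable {d : Type*} [Fintype d] [DecidableEq d]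
variable {F : Type*} [NormedAddCommGroup F] [InnerProductSpace ℝ F] [FiniteDimensional ℝ F]

omit [DecidableEq d] in
/-- Continuity of `ε ↦ ∫_{T^d} G(ε, x) dx` for jointly continuous `G` (compact torus). [folklore] -/
private theorem continuous_integral_param' {E' : Type*} [NormedAddCommGroup E'] [NormedSpace ℝ E']
    {G : ℝ → UnitAddTorus d → E'} (hG : Continuous (Function.uncurry G)) :
    Continuous fun ε => ∫ x, G ε x := by
  have h := continuous_parametric_integral_of_continuous (μ := volume) hG isCompact_univ
  simpa only [Measure.restrict_univ] using h

/-- Passing to `ε → 0⁺` in `V ≤ φ ε` (`0 < ε ≤ 1`) with `φ` continuous at `0`. [folklore] -/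
private theorem le_of_forall_pos_le_of_continuousAt' {V : ℝ} {φ : ℝ → ℝ} (hφ : ContinuousAt φ 0)
    (h : ∀ ε : ℝ, 0 < ε → ε ≤ 1 → V ≤ φ ε) : V ≤ φ 0 := by
  have ht : Tendsto φ (𝓝[>] 0) (𝓝 (φ 0)) := hφ.tendsto.mono_left nhdsWithin_le_nhds
  refine ge_of_tendsto ht ?_
  have hmem : Ioo (0 : ℝ) 1 ∈ 𝓝[>] (0 : ℝ) := Ioo_mem_nhdsGT one_pos
  filter_upwards [hmem] with ε hε using h ε hε.1 hε.2.le

/-! ## 3. Mean control -/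

omit [DecidableEq d] in
/-- **Mean control at a real parameter.** For a continuous zero-mean field `u` on `T^d` and
`a > 0`, with `W = ‖u‖^a u`: `‖∫W‖ ≤ 3^{1+a} (∫‖W − ∫W‖²)^{1/2}` — zero mean of `u = ‖W‖^{β−1}W`,
`β = 1/(1+a)`, the `β`-Hölder bound `norm_rpow_smul_sub_le` and Jensen. [ours] -/
theorem norm_integral_rpow_smul_le {u : UnitAddTorus d → F} (hu : Continuous u)
    (h0 : ∫ x, u x = 0) {a : ℝ} (ha : 0 < a) :
    ‖∫ x, ‖u x‖ ^ a • u x‖ ≤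
      (3 : ℝ) ^ (1 + a) * Real.sqrt (∫ x, ‖‖u x‖ ^ a • u x - ∫ y, ‖u y‖ ^ a • u y‖ ^ 2) := by
  set W : UnitAddTorus d → F := fun x => ‖u x‖ ^ a • u x with hW
  set c : F := ∫ x, W x with hc
  obtain ⟨β, hβ⟩ : ∃ β : ℝ, β = (1 + a)⁻¹ := ⟨_, rfl⟩
  have ha1 : 0 < 1 + a := by linarith
  have hβ0 : 0 < β := by rw [hβ]; exact inv_pos.2 ha1
  have hβ1 : β ≤ 1 := by rw [hβ]; exact inv_le_one_of_one_le₀ (by linarith)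
  have hWc : Continuous W := (hu.norm.rpow_const fun _ => Or.inr ha.le).smul hu
  set V : ℝ := ∫ x, ‖W x - c‖ ^ 2 with hV
  have hV0 : 0 ≤ V := integral_nonneg fun x => sq_nonneg _
  show ‖c‖ ≤ 3 ^ (1 + a) * Real.sqrt V
  rcases eq_or_ne c 0 with hc0 | hc0
  · rw [hc0, norm_zero]; positivity
  have hcn : 0 < ‖c‖ := norm_pos_iff.2 hc0
  -- `g c = ∫ (g c − g (W x))`
  have hgW : ∀ x, ‖W x‖ ^ (β - 1) • W x = u x := fun x => NonlinearPoincare.rpow_smul_rpow_smul ha hβ (u x)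
  have hgc : ‖c‖ ^ (β - 1) • c = ∫ x, (‖c‖ ^ (β - 1) • c - ‖W x‖ ^ (β - 1) • W x) := by
    simp_rw [hgW]
    rw [integral_sub (integrable_const _) hu.integrable_unitAddTorus, h0, sub_zero,
      integral_const, probReal_univ, one_smul]
  -- `‖c‖^β ≤ 3 (√V)^β`
  have hstep : ‖c‖ ^ β ≤ 3 * Real.sqrt V ^ β := by
    have e0 : ‖‖c‖ ^ (β - 1) • c‖ = ‖c‖ ^ β := by
      rw [norm_smul, Real.norm_of_nonneg (Real.rpow_nonneg hcn.le _)]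
      calc ‖c‖ ^ (β - 1) * ‖c‖ = ‖c‖ ^ (β - 1) * ‖c‖ ^ (1 : ℝ) := by rw [Real.rpow_one]
        _ = ‖c‖ ^ β := by rw [← Real.rpow_add hcn, sub_add_cancel]
    have hcont : Continuous fun x => ‖W x - c‖ := (hWc.sub continuous_const).norm
    have h1 : ‖c‖ ^ β ≤ 3 * ∫ x, ‖W x - c‖ ^ β := by
      rw [← e0, hgc]
      calc ‖∫ x, (‖c‖ ^ (β - 1) • c - ‖W x‖ ^ (β - 1) • W x)‖
          ≤ ∫ x, ‖‖c‖ ^ (β - 1) • c - ‖W x‖ ^ (β - 1) • W x‖ := norm_integral_le_integral_norm _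
        _ ≤ ∫ x, 3 * ‖W x - c‖ ^ β := by
            refine integral_mono_of_nonneg (ae_of_all _ fun x => norm_nonneg _)
              ((hcont.rpow_const fun _ => Or.inr hβ0.le).const_mul 3).integrable_unitAddTorus
              (ae_of_all _ fun x => ?_)
            have h := NonlinearPoincare.norm_rpow_smul_sub_le hβ0 hβ1 c (W x)
            rwa [norm_sub_rev c (W x)] at h
        _ = 3 * ∫ x, ‖W x - c‖ ^ β := integral_const_mul _ _
    have h2 : ∫ x, ‖W x - c‖ ^ β ≤ (∫ x, ‖W x - c‖) ^ β :=
      NonlinearPoincare.integral_rpow_le_rpow_integral hcont (fun x => norm_nonneg _) hβ0 hβ1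
    have h3 : (∫ x, ‖W x - c‖) ^ β ≤ Real.sqrt V ^ β :=
      Real.rpow_le_rpow (integral_nonneg fun x => norm_nonneg _)
        (VelocityL4.integral_le_sqrt_integral_sq hcont) hβ0.le
    linarith [mul_le_mul_of_nonneg_left (h2.trans h3) (by norm_num : (0 : ℝ) ≤ 3)]
  -- raise to the power `1/β = 1 + a`
  have hV' : 0 ≤ Real.sqrt V := Real.sqrt_nonneg V
  have e1 : (‖c‖ ^ β) ^ (1 + a) = ‖c‖ := by
    rw [← Real.rpow_mul hcn.le, hβ, inv_mul_cancel₀ ha1.ne', Real.rpow_one]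
  have e2 : (3 * Real.sqrt V ^ β) ^ (1 + a) = 3 ^ (1 + a) * Real.sqrt V := by
    rw [Real.mul_rpow (by norm_num) (Real.rpow_nonneg hV' _), ← Real.rpow_mul hV', hβ,
      inv_mul_cancel₀ ha1.ne', Real.rpow_one]
  calc ‖c‖ = (‖c‖ ^ β) ^ (1 + a) := e1.symm
    _ ≤ (3 * Real.sqrt V ^ β) ^ (1 + a) :=
        Real.rpow_le_rpow (Real.rpow_nonneg hcn.le _) hstep ha1.le
    _ = 3 ^ (1 + a) * Real.sqrt V := e2

/-! ## 4. The nonlinear Poincaré inequality at a real parameter -/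

/-- **Nonlinear Poincaré inequality, real parameter `a > 0` (SIEVELD Lemma NP).** For every
smooth zero-mean vector field `u` on the flat torus `T^d`,
`∫ ‖u‖^{2a+2} ≤ 6 (1 + (3^{1+a})²) (1+a)² d³ · ∫ ‖u‖^{2a} ∑ₖ ‖∂ₖu‖²`
(mean control `(3^{1+a})²`, two-term splitting, regularised gradient `(1+a)²`, Poincaré–Wirtinger
`d³`); the regularisation error `∫‖W_ε − W‖²` is a parametric integral vanishing at `ε = 0`, so no
rate in `ε` is needed. With `a = (q−2)/2` it covers every vorticity moment `Z_q`, `q > 2`.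
[ours; elementary] -/
theorem integral_norm_rpow_le_weighted {u : UnitAddTorus d → F}
    (hu : IsSmooth u) (h0 : HasZeroMean u) {a : ℝ} (ha : 0 < a) :
    ∫ x, ‖u x‖ ^ (2 * a + 2) ≤
      6 * (1 + ((3 : ℝ) ^ (1 + a)) ^ 2) * (1 + a) ^ 2 * (Fintype.card d : ℝ) ^ 3 *
        ∫ x, ‖u x‖ ^ (2 * a) * ∑ k, ‖partialDeriv k u x‖ ^ 2 := by
  set W : UnitAddTorus d → F := fun x => ‖u x‖ ^ a • u x with hW
  set c : F := ∫ x, W x with hc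
  obtain ⟨I, hI⟩ : ∃ I : ℝ, I = ∫ x, ‖u x‖ ^ (2 * a) * ∑ k, ‖partialDeriv k u x‖ ^ 2 := ⟨_, rfl⟩
  obtain ⟨D3, hD3⟩ : ∃ D : ℝ, D = (Fintype.card d : ℝ) ^ 3 := ⟨_, rfl⟩
  obtain ⟨M, hM⟩ : ∃ M : ℝ, M = ((3 : ℝ) ^ (1 + a)) ^ 2 := ⟨_, rfl⟩
  rw [← hI, ← hD3, ← hM]
  have huc : Continuous u := hu.continuous
  have hWc : Continuous W := (huc.norm.rpow_const fun _ => Or.inr ha.le).smul huc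
  have h0' : ∫ x, u x = 0 := h0
  have hcs : Continuous fun x => ∑ k, ‖partialDeriv k u x‖ ^ 2 :=
    continuous_finsetSum _ fun k _ => (hu.partialDeriv k).continuous.norm.pow 2
  have hcs0 : ∀ x, 0 ≤ ∑ k, ‖partialDeriv k u x‖ ^ 2 := fun x =>
    Finset.sum_nonneg fun k _ => sq_nonneg _
  have hI0 : 0 ≤ I := by
    rw [hI]; exact integral_nonneg fun x => mul_nonneg (Real.rpow_nonneg (norm_nonneg _) _) (hcs0 x)
  have hD30 : 0 ≤ D3 := by rw [hD3]; positivity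
  have hM0 : 0 ≤ M := by rw [hM]; positivity
  -- `∫‖u‖^{2a+2} = ∫‖W‖²`
  have hU : ∫ x, ‖u x‖ ^ (2 * a + 2) = ∫ x, ‖W x‖ ^ 2 := by
    refine integral_congr_ae (ae_of_all _ fun x => ?_)
    have hn : 0 ≤ ‖u x‖ := norm_nonneg _
    show ‖u x‖ ^ (2 * a + 2) = ‖‖u x‖ ^ a • u x‖ ^ 2
    rw [norm_smul, Real.norm_of_nonneg (Real.rpow_nonneg hn _)]
    rcases eq_or_lt_of_le hn with hz | hpos
    · rw [← hz, Real.zero_rpow (by linarith)]; simp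
    · rw [mul_pow, ← Real.rpow_natCast, ← Real.rpow_mul hn, show a * ((2 : ℕ) : ℝ) = 2 * a by
        push_cast; ring, ← Real.rpow_natCast ‖u x‖ 2, ← Real.rpow_add hpos]
      norm_num
  -- mean control and two-term splitting
  set V : ℝ := ∫ x, ‖W x - c‖ ^ 2 with hV
  have hV0 : 0 ≤ V := integral_nonneg fun x => sq_nonneg _
  have hmean : ‖c‖ ^ 2 ≤ M * V := by
    have h := norm_integral_rpow_smul_le huc h0' ha
    have h2 : ‖c‖ ^ 2 ≤ ((3 : ℝ) ^ (1 + a) * Real.sqrt V) ^ 2 := pow_le_pow_left₀ (norm_nonneg _) h 2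
    rw [mul_pow, Real.sq_sqrt hV0, ← hM] at h2
    exact h2
  have hUV : ∫ x, ‖W x‖ ^ 2 ≤ 2 * (1 + M) * V := by
    have hpt : ∀ x, ‖W x‖ ^ 2 ≤ 2 * ‖W x - c‖ ^ 2 + 2 * ‖c‖ ^ 2 := by
      intro x
      have h := norm_add_le (W x - c) c
      rw [sub_add_cancel] at h
      have h2 : ‖W x‖ ^ 2 ≤ (‖W x - c‖ + ‖c‖) ^ 2 := pow_le_pow_left₀ (norm_nonneg _) h 2
      nlinarith [sq_nonneg (‖W x - c‖ - ‖c‖)]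
    have hcV : Continuous fun x => ‖W x - c‖ ^ 2 := (hWc.sub continuous_const).norm.pow 2
    have hiV : Integrable (fun x => 2 * ‖W x - c‖ ^ 2) volume :=
      (hcV.const_mul 2).integrable_unitAddTorus
    have hic : Integrable (fun _ : UnitAddTorus d => 2 * ‖c‖ ^ 2) volume := integrable_const _
    have hiW : Integrable (fun x => ‖W x‖ ^ 2) volume := (hWc.norm.pow 2).integrable_unitAddTorus
    calc ∫ x, ‖W x‖ ^ 2 ≤ ∫ x, (2 * ‖W x - c‖ ^ 2 + 2 * ‖c‖ ^ 2) :=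
          integral_mono hiW (hiV.add hic) hpt
      _ = 2 * V + 2 * ‖c‖ ^ 2 := by
          rw [integral_add hiV hic, integral_const_mul, integral_const]
          simp [hV]
      _ ≤ 2 * V + 2 * (M * V) := by linarith
      _ = 2 * (1 + M) * V := by ring
  -- oscillation for every `0 < ε ≤ 1`
  set J : ℝ → ℝ := fun ε => ∫ x, (‖u x‖ ^ 2 + ε) ^ a * ∑ k, ‖partialDeriv k u x‖ ^ 2 with hJ
  set P : ℝ → ℝ := fun ε => ∫ x, ((‖u x‖ ^ 2 + ε) ^ (a / 2) - ‖u x‖ ^ a) ^ 2 * ‖u x‖ ^ 2 with hP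
  have hVε : ∀ ε : ℝ, 0 < ε → ε ≤ 1 → V ≤ 6 * P ε + 3 * (D3 * ((1 + a) ^ 2 * J ε)) := by
    intro ε hε _
    set Wε : UnitAddTorus d → F := fun x => (‖u x‖ ^ 2 + ε) ^ (a / 2) • u x
      with hWε
    set cε : F := ∫ x, Wε x with hcε
    have hWεs : IsSmooth Wε := isSmooth_regA hu hε (a / 2)
    have hWεc : Continuous Wε := hWεs.continuous
    -- (a) `∫‖Wε − W‖² = P ε`
    have ha' : ∫ x, ‖Wε x - W x‖ ^ 2 ≤ P ε := by
      refine le_of_eq (integral_congr_ae (ae_of_all _ fun x => ?_))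
      show ‖Wε x - W x‖ ^ 2 = ((‖u x‖ ^ 2 + ε) ^ (a / 2) - ‖u x‖ ^ a) ^ 2 * ‖u x‖ ^ 2
      simp only [hWε, hW]
      rw [← sub_smul, norm_smul, Real.norm_eq_abs, mul_pow, sq_abs]
    -- (b) `‖cε − c‖² ≤ P ε`
    have hb : ‖cε - c‖ ^ 2 ≤ P ε := by
      have e : cε - c = ∫ x, (Wε x - W x) := by
        rw [hcε, hc, integral_sub hWεc.integrable_unitAddTorus hWc.integrable_unitAddTorus]
      have h1 : ‖cε - c‖ ≤ ∫ x, ‖Wε x - W x‖ := by rw [e]; exact norm_integral_le_integral_norm _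
      have h2 : ∫ x, ‖Wε x - W x‖ ≤ Real.sqrt (∫ x, ‖Wε x - W x‖ ^ 2) :=
        VelocityL4.integral_le_sqrt_integral_sq (hWεc.sub hWc).norm
      have h3 : 0 ≤ ∫ x, ‖Wε x - W x‖ ^ 2 := integral_nonneg fun x => sq_nonneg _
      calc ‖cε - c‖ ^ 2 ≤ Real.sqrt (∫ x, ‖Wε x - W x‖ ^ 2) ^ 2 :=
            pow_le_pow_left₀ (norm_nonneg _) (h1.trans h2) 2
        _ = ∫ x, ‖Wε x - W x‖ ^ 2 := Real.sq_sqrt h3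
        _ ≤ P ε := ha'
    -- (c) Poincaré–Wirtinger
    have hcP : ∫ x, ‖Wε x - cε‖ ^ 2 ≤ D3 * ((1 + a) ^ 2 * J ε) := by
      have hsm : IsSmooth (fun x => Wε x - cε) := hWεs.sub (isSmooth_const cε)
      have hzm : HasZeroMean (fun x => Wε x - cε) := by
        show ∫ x, (Wε x - cε) = 0
        rw [integral_sub hWεc.integrable_unitAddTorus (integrable_const _), integral_const]
        simp [hcε]
      have hP := CodomainSobolev.integral_norm_sq_le_card_cube_mul hsm hzm
      have hg : ∫ x, ∑ k, ‖partialDeriv k (fun x => Wε x - cε) x‖ ^ 2 =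
          ∫ x, ∑ k, ‖partialDeriv k Wε x‖ ^ 2 := by
        refine integral_congr_ae (ae_of_all _ fun x => ?_)
        refine Finset.sum_congr rfl fun k _ => ?_
        have e : (fun x => Wε x - cε) = Wε + fun _ => -cε := by
          funext y; simp [sub_eq_add_neg]
        have hcst : IsContDiff 1 (fun _ : UnitAddTorus d => -cε) := contDiff_const
        rw [e, partialDeriv_add (hWεs.isContDiff (by simp)) hcst, Pi.add_apply]
        simp [Torus.partialDeriv, Torus.lineDeriv]
      have hG : ∫ x, ∑ k, ‖partialDeriv k Wε x‖ ^ 2 ≤ (1 + a) ^ 2 * J ε :=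
        dirichlet_regA_le hu ha.le hε
      calc ∫ x, ‖Wε x - cε‖ ^ 2
          ≤ (Fintype.card d : ℝ) ^ 3 * ∫ x, ∑ k, ‖partialDeriv k (fun x => Wε x - cε) x‖ ^ 2 := hP
        _ = D3 * ∫ x, ∑ k, ‖partialDeriv k Wε x‖ ^ 2 := by rw [hg, hD3]
        _ ≤ D3 * ((1 + a) ^ 2 * J ε) := mul_le_mul_of_nonneg_left hG hD30
    -- (d) three-term splitting
    have hsplit : V ≤ 3 * (∫ x, ‖Wε x - W x‖ ^ 2) + 3 * (∫ x, ‖Wε x - cε‖ ^ 2) +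
        3 * ‖cε - c‖ ^ 2 := by
      have hpt : ∀ x, ‖W x - c‖ ^ 2 ≤
          3 * ‖Wε x - W x‖ ^ 2 + 3 * ‖Wε x - cε‖ ^ 2 + 3 * ‖cε - c‖ ^ 2 := by
        intro x
        have e : W x - c = (Wε x - cε) + (cε - c) - (Wε x - W x) := by abel
        have h1 := norm_sub_le ((Wε x - cε) + (cε - c)) (Wε x - W x)
        have h2 := norm_add_le (Wε x - cε) (cε - c)
        rw [← e] at h1
        have h3 : ‖W x - c‖ ≤ ‖Wε x - W x‖ + ‖Wε x - cε‖ + ‖cε - c‖ := by linarith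
        have h4 : ‖W x - c‖ ^ 2 ≤ (‖Wε x - W x‖ + ‖Wε x - cε‖ + ‖cε - c‖) ^ 2 :=
          pow_le_pow_left₀ (norm_nonneg _) h3 2
        nlinarith [sq_nonneg (‖Wε x - W x‖ - ‖Wε x - cε‖), sq_nonneg (‖Wε x - cε‖ - ‖cε - c‖),
          sq_nonneg (‖Wε x - W x‖ - ‖cε - c‖)]
      have hca : Continuous fun x => ‖Wε x - W x‖ ^ 2 := (hWεc.sub hWc).norm.pow 2
      have hcb : Continuous fun x => ‖Wε x - cε‖ ^ 2 := (hWεc.sub continuous_const).norm.pow 2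
      have hia : Integrable (fun x => 3 * ‖Wε x - W x‖ ^ 2) volume :=
        (hca.const_mul 3).integrable_unitAddTorus
      have hib : Integrable (fun x => 3 * ‖Wε x - cε‖ ^ 2) volume :=
        (hcb.const_mul 3).integrable_unitAddTorus
      have hicc : Integrable (fun _ : UnitAddTorus d => 3 * ‖cε - c‖ ^ 2) volume :=
        integrable_const _
      have hiab : Integrable (fun x => 3 * ‖Wε x - W x‖ ^ 2 + 3 * ‖Wε x - cε‖ ^ 2) volume :=
        hia.add hib
      have hiV : Integrable (fun x => ‖W x - c‖ ^ 2) volume :=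
        ((hWc.sub continuous_const).norm.pow 2).integrable_unitAddTorus
      calc V ≤ ∫ x, (3 * ‖Wε x - W x‖ ^ 2 + 3 * ‖Wε x - cε‖ ^ 2 + 3 * ‖cε - c‖ ^ 2) :=
            integral_mono hiV (hiab.add hicc) hpt
        _ = 3 * (∫ x, ‖Wε x - W x‖ ^ 2) + 3 * (∫ x, ‖Wε x - cε‖ ^ 2) + 3 * ‖cε - c‖ ^ 2 := by
            rw [integral_add hiab hicc, integral_add hia hib, integral_const_mul, integral_const_mul,
              integral_const]
            simp
    linarith [hsplit, ha', hb, hcP]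
  -- `ε → 0⁺` by continuity of the parametric integral
  have hJc : Continuous J := by
    refine continuous_integral_param' ?_
    have h1 : Continuous fun p : ℝ × UnitAddTorus d => (‖u p.2‖ ^ 2 + p.1) ^ a :=
      (((huc.comp continuous_snd).norm.pow 2).add continuous_fst).rpow_const fun _ => Or.inr ha.le
    exact h1.mul (hcs.comp continuous_snd)
  have hPc : Continuous P := by
    refine continuous_integral_param' ?_
    have h1 : Continuous fun p : ℝ × UnitAddTorus d => (‖u p.2‖ ^ 2 + p.1) ^ (a / 2) :=
      (((huc.comp continuous_snd).norm.pow 2).add continuous_fst).rpow_const fun _ =>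
        Or.inr (by positivity)
    have h2 : Continuous fun p : ℝ × UnitAddTorus d => ‖u p.2‖ ^ a :=
      (huc.comp continuous_snd).norm.rpow_const fun _ => Or.inr ha.le
    exact ((h1.sub h2).pow 2).mul ((huc.comp continuous_snd).norm.pow 2)
  have hφc : ContinuousAt (fun ε : ℝ => 6 * P ε + 3 * (D3 * ((1 + a) ^ 2 * J ε))) 0 :=
    (hPc.continuousAt.const_mul 6).add (((hJc.continuousAt.const_mul _).const_mul _).const_mul 3)
  have hVle : V ≤ 3 * (D3 * ((1 + a) ^ 2 * I)) := by
    have h := le_of_forall_pos_le_of_continuousAt' hφc hVε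
    have hJ0 : J 0 = I := by
      simp only [hJ, hI, add_zero]
      refine integral_congr_ae (ae_of_all _ fun x => ?_)
      have : (‖u x‖ ^ 2) ^ a = ‖u x‖ ^ (2 * a) := by
        rw [← Real.rpow_natCast, ← Real.rpow_mul (norm_nonneg _)]; norm_num
      simp only [this]
    have hP0 : P 0 = 0 := by
      simp only [hP, add_zero]
      refine (integral_congr_ae (ae_of_all _ fun x => ?_)).trans (integral_zero _ _)
      show ((‖u x‖ ^ 2) ^ (a / 2) - ‖u x‖ ^ a) ^ 2 * ‖u x‖ ^ 2 = (0 : ℝ)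
      have : (‖u x‖ ^ 2) ^ (a / 2) = ‖u x‖ ^ a := by
        rw [← Real.rpow_natCast, ← Real.rpow_mul (norm_nonneg _)]
        congr 1
        push_cast
        ring
      rw [this, sub_self]; ring
    simpa only [hP0, mul_zero, zero_add, hJ0] using h
  calc ∫ x, ‖u x‖ ^ (2 * a + 2) = ∫ x, ‖W x‖ ^ 2 := hU
    _ ≤ 2 * (1 + M) * V := hUV
    _ ≤ 2 * (1 + M) * (3 * (D3 * ((1 + a) ^ 2 * I))) := by gcongr
    _ = 6 * (1 + M) * (1 + a) ^ 2 * D3 * I := by ring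

end CodomainNP

end Summit.NavierStokesRegularity.FunctionalMining
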